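import Literature.Analysis.SegalBargmann.FockUnitaryAction
import HarnessLib

/-!
# Substitution eigenvectors among Fock polynomials: the `2 × 2` determinant, the pairing polynomial, the constants

Topic `Analysis/SegalBargmann`; namespace `Literature.Analysis.SegalBargmann`.  Pure polynomial algebra over the tree's
linear substitution `linSubst M : ℂ[X_τ] →ₐ ℂ[X_τ]`, `X_y ↦ Σ_{y'} M_{y y'} X_{y'}` (`FockUnitaryAction`, Folland's
`F ↦ F ∘ U⁻¹` on the Fock model is `linSubst (star U)`).  Proved lemmas only: **no named facts, no records, 0 proof holes**.

Three families of polynomials and how a substitution whose matrix is supported blockwise acts on them: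

* §1 `linSubst_X_eq_sum_of_support`: if the row of `M` at the variable `y` is supported on the image of an injective
  family `x : β → τ`, then `linSubst M (X y) = Σ_b M_{y, x b} X_{x b}` (bookkeeping for Kronecker / block-diagonal `M`).
* §2 the **`2 × 2` determinant** `det2 x = X_{x₀₀} X_{x₁₁} − X_{x₀₁} X_{x₁₀}` of a `2 × 2` array of variables: if `M`
  substitutes the rows of the array by a matrix `N ∈ M₂(ℂ)` acting on the FIRST index, the same for both columns
  (`linSubst M (X (x a j)) = Σ_b N_{a b} X_{x b j}`), then **`linSubst M (det2 x) = det N • det2 x`**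
  (`linSubst_det2`).
* §3 the **pairing polynomial** `pairingPoly z w = Σ_a X_{z a} X_{w a}` of two families of variables indexed by a finite
  `α`: if `M` substitutes the `z`'s by `N` and the `w`'s by `N'` with `Nᵀ N' = 1`, then
  **`linSubst M (pairingPoly z w) = pairingPoly z w`** (`linSubst_pairingPoly`); in particular for `N' = N̄` with `N`
  unitary (`Nᵀ N̄ = (N^* N)‾ = 1`, `linSubst_pairingPoly_of_unitary`).
* §4 the constants: `linSubst M (C c) = C c` (tree `linSubst_C`), restated in the eigen-form `= (1 : ℂ) • C c`.

Use (pub-hodgecm model cell, rows A12/A34 / `SK = 𝒮^κ`, STEP 3 (d)): these are the three printed generators of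
PerL v5 Lemma 4.1(b) (tex ll. 496–507) — `det(z)` at the place `ι₁` (`κ_{ι₁} = ∧²𝔭₊`), `P = Σ_a z_a w_a` at the places
of kind `Σ₁₂`, `1` at the places of kind `D₁₂` — and `Weil1964/ArchFollandCompactKType.arch_compact_apply_follandFock
_of_linSubst_eq_smul` turns each eigen-identity `linSubst (star V) φ = χ • φ` into the eigen-equation of the archimedean
implementer on the Schwartz vector `follandFock e_D φ`.  The entries of `star V` for the cell's `V = placeBlock
(placeFollandUnitary k)` are census-time computations over the constructed objects, not made here.

Dictionary with print: Folland [Folland1989] Prop. (4.39) / Ch. 4 §5 ("U ∈ U(n), F ∈ 𝓟_k ⟹ F ∘ U⁻¹ ∈ 𝓟_k"): the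
compact group acts on Fock polynomials by linear substitution; the invariants `det`, `Σ_a z_a w̄_a` are the classical
ones (Weyl, *The Classical Groups*, II.A) — cited as dictionary only; everything below is proved by `ring`-level algebra.

## Mathlib / tree

Mathlib: `MvPolynomial.X`, `MvPolynomial.C`, `MvPolynomial.smul_eq_C_mul`, `map_sum`, `Finset.sum_comm`,
`Finset.sum_subset`, `Finset.sum_image`, `Matrix.det_fin_two`, `Matrix.mul_apply`, `Matrix.one_apply`,
`Matrix.mem_unitaryGroup_iff'`, `Fin.sum_univ_two`.
Tree: `linSubst` (`linSubst_X`, `linSubst_C`).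

## References
* [Folland1989] G. B. Folland, *Harmonic Analysis in Phase Space*, Princeton UP (1989), Prop. (4.39), Ch. 4 §5.

## Provenance

Written under the LEAN-IN-TREE rule (2026-08-18) for the pub-hodgecm formalisation cell (HAZARD γ-K (b) / D5-arch,
STEP 3 (d), binder-2 lane gen 4; LEAF D3).  KERNEL only; all statements are proved.
-/

set_option autoImplicit false

noncomputable section

open MvPolynomial
open scoped BigOperators Matrix

namespace Literature.Analysis.SegalBargmann

variable {τ : Type*} [Fintype τ] [DecidableEq τ]

/-! ## §1 Substitution of a variable whose row is supported on an injective family -/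

/-- **Row supported on an injective family**: if `M_{y y'} = 0` unless `y' = x b` for some `b`, and `x` is injective,
then `linSubst M (X y) = Σ_b M_{y, x b} X_{x b}`. [folklore] -/
theorem linSubst_X_eq_sum_of_support {β : Type*} [Fintype β] [DecidableEq β] (M : Matrix τ τ ℂ) (y : τ)
    (x : β → τ) (hx : Function.Injective x) (hsupp : ∀ y', (∀ b, y' ≠ x b) → M y y' = 0) :
    linSubst M (X y) = ∑ b, C (M y (x b)) * X (x b) := by
  rw [linSubst_X]
  have himg : ∑ y' ∈ (Finset.univ : Finset β).image x, C (M y y') * X y' =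
      ∑ b, C (M y (x b)) * X (x b) :=
    Finset.sum_image fun b _ b' _ h => hx h
  rw [← himg]
  symm
  refine Finset.sum_subset (Finset.subset_univ _) fun y' _ hy' => ?_
  have h0 : M y y' = 0 := hsupp y' fun b hb => hy' (Finset.mem_image.mpr ⟨b, Finset.mem_univ _, hb.symm⟩)
  rw [h0, C_0, zero_mul]

/-! ## §2 The `2 × 2` determinant of an array of variables -/

/-- The `2 × 2` determinant `X_{x₀₀} X_{x₁₁} − X_{x₀₁} X_{x₁₀}` of a `2 × 2` array of variables `x a j`.
[folklore] -/
def det2 (x : Fin 2 → Fin 2 → τ) : MvPolynomial τ ℂ := X (x 0 0) * X (x 1 1) - X (x 0 1) * X (x 1 0)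

omit [Fintype τ] [DecidableEq τ] in
/-- Unfolding `det2`. [folklore] -/
theorem det2_def (x : Fin 2 → Fin 2 → τ) : det2 x = X (x 0 0) * X (x 1 1) - X (x 0 1) * X (x 1 0) := rfl

omit [DecidableEq τ] in
/-- **The determinant is a substitution eigenvector**: if `M` acts on the first index of the array by `N ∈ M₂(ℂ)`,
the same on both columns — `linSubst M (X (x a j)) = Σ_b N_{a b} X_{x b j}` — then `linSubst M (det2 x) = det N • det2 x`.
[folklore] -/
theorem linSubst_det2 (M : Matrix τ τ ℂ) (x : Fin 2 → Fin 2 → τ) (N : Matrix (Fin 2) (Fin 2) ℂ)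
    (hM : ∀ a j, linSubst M (X (x a j)) = ∑ b, C (N a b) * X (x b j)) :
    linSubst M (det2 x) = N.det • det2 x := by
  simp only [det2, map_sub, map_mul, hM, Fin.sum_univ_two, Matrix.det_fin_two, smul_eq_C_mul, map_sub C, map_mul C]
  ring

/-- The same for an array substituted on the first index by `N` read through entries `M_{x a j, x b j} = N_{a b}` and
vanishing elsewhere in those rows (`x` injective as a map of `Fin 2 × Fin 2`). [folklore] -/
theorem linSubst_det2_of_entries (M : Matrix τ τ ℂ) (x : Fin 2 → Fin 2 → τ)
    (hx : Function.Injective fun p : Fin 2 × Fin 2 => x p.1 p.2) (N : Matrix (Fin 2) (Fin 2) ℂ)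
    (hN : ∀ a j b, M (x a j) (x b j) = N a b) (hcol : ∀ a j b j', j' ≠ j → M (x a j) (x b j') = 0)
    (hsupp : ∀ a j y', (∀ p : Fin 2 × Fin 2, y' ≠ x p.1 p.2) → M (x a j) y' = 0) :
    linSubst M (det2 x) = N.det • det2 x := by
  refine linSubst_det2 M x N fun a j => ?_
  rw [linSubst_X_eq_sum_of_support M (x a j) (fun p : Fin 2 × Fin 2 => x p.1 p.2) hx (hsupp a j),
    Fintype.sum_prod_type]
  refine Finset.sum_congr rfl fun b _ => ?_
  simp only [Fin.sum_univ_two]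
  fin_cases j
  · simp [hN, hcol a 0 b 1 (by decide)]
  · simp [hN, hcol a 1 b 0 (by decide)]

/-! ## §3 The pairing polynomial `Σ_a X_{z a} X_{w a}` -/

/-- The pairing polynomial `Σ_a X_{z a} X_{w a}` of two families of variables. [folklore] -/
def pairingPoly {α : Type*} [Fintype α] (z w : α → τ) : MvPolynomial τ ℂ := ∑ a, X (z a) * X (w a)

omit [Fintype τ] [DecidableEq τ] in
/-- Unfolding `pairingPoly`. [folklore] -/
theorem pairingPoly_def {α : Type*} [Fintype α] (z w : α → τ) : pairingPoly z w = ∑ a, X (z a) * X (w a) := rfl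

omit [DecidableEq τ] in
/-- **The pairing polynomial is invariant** when the `z`'s are substituted by `N` and the `w`'s by `N'` with
`Nᵀ N' = 1`. [folklore] -/
theorem linSubst_pairingPoly {α : Type*} [Fintype α] [DecidableEq α] (M : Matrix τ τ ℂ) (z w : α → τ)
    (N N' : Matrix α α ℂ) (hz : ∀ a, linSubst M (X (z a)) = ∑ b, C (N a b) * X (z b))
    (hw : ∀ a, linSubst M (X (w a)) = ∑ b, C (N' a b) * X (w b)) (hNN : Nᵀ * N' = 1) :
    linSubst M (pairingPoly z w) = pairingPoly z w := by
  simp only [pairingPoly, map_sum, map_mul, hz, hw]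
  -- expand the products of sums and regroup by `(b, c)`
  have hexp : ∀ a, (∑ b, C (N a b) * X (z b)) * (∑ c, C (N' a c) * X (w c)) =
      ∑ b, ∑ c, C (N a b * N' a c) * (X (z b) * X (w c) : MvPolynomial τ ℂ) := by
    intro a
    rw [Finset.sum_mul_sum]
    refine Finset.sum_congr rfl fun b _ => Finset.sum_congr rfl fun c _ => ?_
    rw [map_mul]; ring
  simp only [hexp]
  rw [Finset.sum_comm]
  refine Finset.sum_congr rfl fun b _ => ?_
  rw [Finset.sum_comm]
  have hentry : ∀ c, ∑ a, C (N a b * N' a c) * (X (z b) * X (w c) : MvPolynomial τ ℂ) =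
      C ((Nᵀ * N') b c) * (X (z b) * X (w c)) := by
    intro c
    rw [← Finset.sum_mul, ← map_sum, Matrix.mul_apply]
    rfl
  simp only [hentry, hNN, Matrix.one_apply]
  rw [Finset.sum_eq_single b (fun c _ hc => by rw [if_neg (Ne.symm hc), C_0, zero_mul]) (fun h => absurd
    (Finset.mem_univ b) h), if_pos rfl, C_1, one_mul]

omit [DecidableEq τ] in
/-- **… in particular for `N' = N̄` with `N` unitary** (`Nᵀ N̄ = (N^* N)‾ = 1`): the case of `U(V₊) ⊗ 1` acting on the
variables of two lines of OPPOSITE signs (standard on one, conjugate on the other). [folklore] -/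
theorem linSubst_pairingPoly_of_unitary {α : Type*} [Fintype α] [DecidableEq α] (M : Matrix τ τ ℂ) (z w : α → τ)
    (N : Matrix α α ℂ) (hN : N ∈ Matrix.unitaryGroup α ℂ)
    (hz : ∀ a, linSubst M (X (z a)) = ∑ b, C (N a b) * X (z b))
    (hw : ∀ a, linSubst M (X (w a)) = ∑ b, C (star (N a b)) * X (w b)) :
    linSubst M (pairingPoly z w) = pairingPoly z w := by
  refine linSubst_pairingPoly M z w N (N.map star) hz (fun a => by simpa using hw a) ?_
  have h := Matrix.mem_unitaryGroup_iff'.mp hN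
  rw [Matrix.star_eq_conjTranspose] at h
  -- `Nᵀ N̄ = (Nᴴ N)‾`
  have h2 : Nᵀ * N.map star = (Nᴴ * N).map star := by
    ext i j
    simp [Matrix.mul_apply, Matrix.conjTranspose_apply, Matrix.map_apply]
  rw [h2, h, Matrix.map_one _ (star_zero ℂ) (star_one ℂ)]

/-! ## §4 The constants -/

omit [Fintype τ] [DecidableEq τ] in
/-- Constants are fixed by every substitution, in eigen-form with eigenvalue `1`. [folklore] -/
theorem linSubst_C_eq_one_smul [Fintype τ] (M : Matrix τ τ ℂ) (c : ℂ) :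
    linSubst M (C c) = (1 : ℂ) • C c := by
  rw [linSubst_C, one_smul]

omit [Fintype τ] [DecidableEq τ] in
/-- `linSubst M 1 = 1`. [folklore] -/
theorem linSubst_one [Fintype τ] (M : Matrix τ τ ℂ) : linSubst M (1 : MvPolynomial τ ℂ) = 1 := map_one _

end Literature.Analysis.SegalBargmann

end
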